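import Mathlib
import HarnessLib
import Summits.HubbardSuperconductivity.HubbardSuperconductivity.Theorems.KLProgrammeKLRegimeEngineV17F2ClosersVGQDoors
import Summits.HubbardSuperconductivity.HubbardSuperconductivity.Theorems.KLProgrammeKLRegimeEngineV8PairTransferExport8

/-!
# K3 ENGINE (stmt-HubbardSuperconductivity-20437 `KLRegimeEngineV17F2`, V2 registration 27cd7ed0f55f17c0), row (c) `stub_engine_step_values`:
# THE IN-CLASS ROW `hexLad` ((E2-F2)ₙ) FROM ONE ∃-PACKAGE — class #5's RESOLVENT-TOWER rows — at `(klEngGeo14, klEngQ9dG klEngGeo14 P R)`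
# (cell gate-hubbard-kl, seat hubbard-kl-k3c2-p2 g24; sequel of `…ClosersVGQ` p711453 / `…VGQDoors` p711876 / `…VGQOut` / `…VGQIso`)

WHAT.  The (c) credit's first residual row `hexLad` = (E2-F2)ₙ `PairLadderStepAtV17F2 … klEngGeo14 … (klEngQ9dG klEngGeo14 P R) … n` under row (c)'s binder prefix.  Its
producer of record is class #5's `EngineV8.pairLadderStepAtV17F2_of_relFamilyK5_klCT8` (…PairTransferExport8): the KEYED family `hfam` IS the stub's `htr` at `n − 1`
(`PairTransferRelFamilyK5 L M klEngGeoTh P (klCT8 P R (klEngQ7 P R) klEngGeo14 klEngGeoTh) β U μ (n−1)`), the lower frame `Kₙ₋₁` is admissible by the history, `β ≤ L`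
by token #16, `2¹⁸ ≤ klEngGeo14.bhi = 2²⁴`, `0 ≤ klEngGeoTh.CF`; what remains is the RESOLVENT-TOWER PACKAGE `htower` (per in-class `Qm`: the smeared array `X`, its
Neumann inverse `Nm`, the member weight `w₁`, the error arrays `Ea ≤ E₁ ≤ e₁`, the bar bound `r′`, the three smallness/mass/edge lines and the SLOT line
`E₁ ≤ drivePBar + eremBar + thermalBar + legDressBarQ2 + (KlamU)²(phGain + phGain) + frameShiftBar`) together with an a-priori array bound `m` (`0 ≤ m`,
`‖klPairArrayF … (n−1)‖ ≤ m`, `m·bhi/4 ≤ 1/3`; the canonical `m = 2|U| + D·U²` of `rowC_pairArray_apriori` qualifies — §1).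
* §1 `rowC_pairArray_apriori_unif` — the canonical UNIFORM `m` with `m·(klEngGeo14.bhi/4) ≤ 1/3` under row (c)'s U-door;
* §2 **`rowC_hexLad_of_pkg hexLadPkg : <the hexLad hypothesis of A24a1G14.stub_engine_step_values_of_producers VERBATIM>`**, `hexLadPkg` = row (c)'s prefix →
  `∃ m, 0 ≤ m ∧ (∀ Qm s t, ‖klPairArrayF … (n−1) Qm s t‖ ≤ m) ∧ m·(klEngGeo14.bhi/4) ≤ 1/3 ∧ htower` (the tower rows VERBATIM at `G = G′ := klEngGeo14`, `Gth := klEngGeoTh`,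
  `Q₀ := klEngQ7 P R`, `Q := klEngQ9dG klEngGeo14 P R`) [owner: class #5 «88b»/«95v2» spine + E1's resolvent data].
The sibling `…ClosersVGQPkg` composes: `A24a1G14.stub_engine_step_values_of_producers_pkg₃ hexLadPkg hexOutPkg : <row (c) VERBATIM>`.
Plumbing only; the package is a HYPOTHESIS; nothing here asserts (c), any open row of 20437, K3 or superconductivity.  0 kit · 0 lit.
-/

noncomputable section

namespace Summit.HubbardSuperconductivity.HubbardSuperconductivity.Theorems.EngineV8

set_option linter.dupNamespace false -- summit = problem name (single-conjunct summit), D-0017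

open Real Set Finset Complex Matrix Literature.MathematicalPhysics.QuantumLattice GrassmannAlgebra
open Literature.Probability.LatticeModels hiding torusSupNorm
open Literature.MathematicalPhysics.QuantumLattice.FermiRG
open Summit.HubbardSuperconductivity.HubbardSuperconductivity.Theorems.KLProgrammeLegKernels
open Summit.HubbardSuperconductivity.HubbardSuperconductivity.Theorems.DispersionFlow
open Summit.HubbardSuperconductivity.HubbardSuperconductivity.Theorems.KLRegimeSplit

/-! ## §1 The canonical uniform a-priori array bound -/

section Apriori

variable {L M : ℕ} [NeZero L] [NeZero M] {P : SplitConsts} {Q : EngConsts} {β U μ : ℝ} {n : ℕ}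

/-- **UNIFORM a-priori pair array** at scale `n`: `m := 2|U| + D·U²` (`D = C_W + klLegKappa·Q.CR·Klam³`) bounds `‖klPairArrayF … n Qm s t‖` for EVERY `Qm`, with `0 ≤ m`,
`m² ≤ 2⁸(KlamU)²`, and — under `|U|·2²⁴ ≤ 1/8` — `m·(2²⁴/4) ≤ 1/3` (`m ≤ 2.1|U| ≤ 2.1·2⁻²⁷`). -/
theorem rowC_pairArray_apriori_unif (hP : P.WF) (hQ : 0 ≤ Q.CR) (hcU' : (P.C_W + klLegKappa * Q.CR * P.Klam ^ 3) * |U| ≤ 1 / 10)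
    (hU24 : |U| * 2 ^ 24 ≤ 1 / 8) (harr : PairArrayAtV17F L M P Q β U μ n) :
    0 ≤ 2 * |U| + (P.C_W + klLegKappa * Q.CR * P.Klam ^ 3) * U ^ 2 ∧
      (∀ Qm s t, ‖klPairArrayF L M β U μ n Qm s t‖ ≤ 2 * |U| + (P.C_W + klLegKappa * Q.CR * P.Klam ^ 3) * U ^ 2) ∧
        (2 * |U| + (P.C_W + klLegKappa * Q.CR * P.Klam ^ 3) * U ^ 2) * ((2 : ℝ) ^ 24 / 4) ≤ 1 / 3 := by
  set D := P.C_W + klLegKappa * Q.CR * P.Klam ^ 3 with hD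
  have hD0 : 0 ≤ D := klValTol_nonneg hP hQ
  have hUa : 0 ≤ |U| := abs_nonneg U
  have hDU2 : D * U ^ 2 ≤ |U| / 10 := by
    have : D * U ^ 2 = D * |U| * |U| := by rw [← sq_abs]; ring
    rw [this]; nlinarith
  refine ⟨by positivity, fun Qm s t => ?_, by nlinarith⟩
  obtain ⟨u, hu0, hu2, hball⟩ := harr Qm
  by_cases hs : s ∈ klBall L μ 0
  · by_cases ht : t ∈ klBall L μ 0
    · rw [klPairArrayF_apply_of_mem L M β U μ n Qm hs ht]
      have h1 := hball s hs t ht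
      have hu : ‖(u : ℂ)‖ = u := by rw [Complex.norm_real, Real.norm_eq_abs, abs_of_nonneg hu0]
      calc ‖klPairAmplitude L M β U μ (klFlowFrameU L M β U μ n) n Qm s t‖
          = ‖(klPairAmplitude L M β U μ (klFlowFrameU L M β U μ n) n Qm s t - (u : ℂ)) + (u : ℂ)‖ := by rw [sub_add_cancel]
        _ ≤ ‖klPairAmplitude L M β U μ (klFlowFrameU L M β U μ n) n Qm s t - (u : ℂ)‖ + ‖(u : ℂ)‖ := norm_add_le _ _
        _ ≤ D * U ^ 2 + 2 * |U| := by rw [hu]; exact add_le_add h1 hu2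
        _ = 2 * |U| + D * U ^ 2 := by ring
    · rw [klPairArrayF_apply_of_not_mem_right L M β U μ n Qm s ht, norm_zero]; positivity
  · rw [klPairArrayF_apply_of_not_mem L M β U μ n Qm hs t, norm_zero]; positivity

end Apriori

/-! ## §2 (E2-F2)ₙ from the resolvent-tower package -/

section Lad

set_option maxHeartbeats 1600000 in -- one literal ∃-package through the class-#5 door; plumbing only
/-- **ROW (c)'s IN-CLASS producer `hexLad` FROM ONE ∃-PACKAGE** — class #5's `pairLadderStepAtV17F2_of_relFamilyK5_klCT8` at `(klEngGeo14, klEngQ9dG klEngGeo14 P R)` with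
`hfam :=` the stub's `htr` at `n − 1`, the lower frame from the history, `β ≤ L` from token #16, `2¹⁸ ≤ 2²⁴ = klEngGeo14.bhi`, `0 ≤ klEngGeoTh.CF`; the package hands the
a-priori bound `m` (§1 supplies a canonical one) and the RESOLVENT-TOWER rows per in-class `Qm` VERBATIM.  The conclusion is EXACTLY the `hexLad` hypothesis of
`A24a1G14.stub_engine_step_values_of_producers(₂)`.  HYPOTHESIS, not assertion. -/
theorem rowC_hexLad_of_pkg
    (hexLadPkg : ∀ (P : SplitConsts) (R : RenConsts) (c : ℝ), P.WF → R.WF2 → 0 < c → c ≤ klEngC₃7GU klEngGeo14 P R →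
          ∀ μ ∈ klWindowC, ∀ U : ℝ, 0 < U → U ≤ klEngU₀12GQ klEngGeo14 (klEngQ9dG klEngGeo14 P R) P R c → ∀ β : ℝ, klBetaMin ≤ β → β ≤ Real.exp (c / U ^ 2) →
            ∀ (L M : ℕ) [NeZero L] [NeZero M], klEngL₄ P R β U ≤ L → klEngM₃ β U L ≤ M →
              ∀ n : ℕ, 1 ≤ n → n ≤ nScales β + 1 → IsKLRegime U c (-(n : ℤ)) →
                HistP klPredsV17F2 L M klEngGeo14 P (klEngQ9dG klEngGeo14 P R) R β U μ 0 n →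
                  FrameOK R U (nScales β) μ (klFlowFrameU L M β U μ n) →
                    KernelNormsV4 L M P (klEngQ9dG klEngGeo14 P R) β U μ (klFlowFrameU L M β U μ n) n →
                      (∀ j ≤ n, (KernelNormsLevels L M P (klEngQ9dG klEngGeo14 P R) β U μ (klFlowFrameU L M β U μ n) j ∧
                        KernelNormsWt4 L M (klWtBudget P (klEngQ9dG klEngGeo14 P R) U j) β U μ (klFlowFrameU L M β U μ n) j)) →
                        (∀ j ≤ n, LevelsUExportMixedAt L M (klCU2 P R (klEngQ7 P R)) P β U μ j) →
                          (∀ j ≤ n, IsoTupleLineBAt L M klE5AM klE5cM (klE5dM P R) P β U μ j) →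
                            (∀ j ≤ n, PairTransferRelFamilyK5 L M klEngGeoTh P (klCT8 P R (klEngQ7 P R) klEngGeo14 klEngGeoTh) β U μ j) →
            ∃ m : ℝ, 0 ≤ m ∧ (∀ Qm s t, ‖klPairArrayF L M β U μ (n - 1) Qm s t‖ ≤ m) ∧ m * (klEngGeo14.bhi / 4) ≤ 1 / 3 ∧
              (∀ Qm : TorusSite 2 L, IsPairClassAt L Qm n → ∃ (X Nm : Matrix (TorusSite 2 L) (TorusSite 2 L) ℂ) (w₁ : TorusSite 2 L → ℝ) (Ea E₁ : TorusSite 2 L → TorusSite 2 L → ℝ) (r' e₁ : ℝ), 0 ≤ r' ∧ 0 ≤ e₁ ∧ (∀ x y, ¬(x ∈ klBall L μ 0 ∧ y ∈ klBall L μ 0) → X x y = 0) ∧ (∀ k ∈ klBall L μ 0, ∀ k' ∈ klBall L μ 0, X k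
                  k' = klCovSmearedPairAmplitude L M β U μ (klFlowFrameU L M β U μ (n - 1)) (n - 1) (softCovOf L M β μ (klFlowFrameU L M β U μ (n - 1)) (softSymbolCompl L M β μ (klFlowFrameU L M β U μ (n - 1)) (n - 1) n)) Qm k k') ∧ (∀ x y, 0 ≤ Ea x y) ∧ (1 + Matrix.diagonal (fun p => (w₁ p : ℂ)) * X) * Nm = 1 ∧ (∀ k
                  ∈ klBall L μ 0, ∀ k' ∈ klBall L μ 0, ‖klPairArrayF L M β U μ n Qm k k' - (X * Nm) k k'‖ ≤ Ea k k') ∧ (∀ x y, transferBarRelIdx L klEngGeoTh P (klCT8 P R (klEngQ7 P R) klEngGeo14 klEngGeoTh) β U (n - 1) (n - 1) Qm x y ≤ r') ∧ (∀ x y, Ea x y + (transferBarRelIdx L klEngGeoTh P (klCT8 P R (klEngQ7 P R)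
                  klEngGeo14 klEngGeoTh) β U (n - 1) (n - 1) Qm x y + 3 / 2 * (3 / 2 * m) * ∑ t, transferBarRelIdx L klEngGeoTh P (klCT8 P R (klEngQ7 P R) klEngGeo14 klEngGeoTh) β U (n - 1) (n - 1) Qm x t * |w₁ t| + 3 / 2 * (3 / 2 * m + r') * ∑ a, |w₁ a| * transferBarRelIdx L klEngGeoTh P (klCT8 P R (klEngQ7 P R)
                  klEngGeo14 klEngGeoTh) β U (n - 1) (n - 1) Qm a y + 9 / 4 * (3 / 2 * m + r') * (3 / 2 * m) * ∑ a, ∑ t, |w₁ a| * transferBarRelIdx L klEngGeoTh P (klCT8 P R (klEngQ7 P R) klEngGeo14 klEngGeoTh) β U (n - 1) (n - 1) Qm a t * |w₁ t|) ≤ E₁ x y) ∧ (∀ x y, E₁ x y ≤ e₁) ∧ (3 / 2 * m + r') * ∑ a, |w₁ a| ≤ 1 /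
                  3 ∧ (∑ p, |w₁ p| ≤ 3 / 4 * klEngGeo14.bhi) ∧ (∑ p, (|w₁ p| - w₁ p) ≤ klEdge klEngGeo14 n (klTorusNorm L Qm)) ∧ (∀ k ∈ klBall L μ 0, ∀ k' ∈ klBall L μ 0, E₁ k k' ≤ drivePBar klEngGeo14 P U (n - 1) + eremBar klEngGeo14 P (klEngQ9dG klEngGeo14 P R) U β L (n - 1) + thermalBar klEngGeo14 P U β n +
                  legDressBarQ2 klEngGeo14 P (klEngQ9dG klEngGeo14 P R) U n (legSliceCountT L β μ (klFlowFrameU L M β U μ n) n ![k', Qm - k', Qm - k, k]) + (P.Klam * U) ^ 2 * (klEngGeo14.phGain n (klTorusNorm L (k - k')) + klEngGeo14.phGain n (klTorusNorm L (k + k' - Qm))) + frameShiftBar P (klEngQ9dG klEngGeo14 P R)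
                  U n))) :
    ∀ (P : SplitConsts) (R : RenConsts) (c : ℝ), P.WF → R.WF2 → 0 < c → c ≤ klEngC₃7GU klEngGeo14 P R →
      ∀ μ ∈ klWindowC, ∀ U : ℝ, 0 < U → U ≤ klEngU₀12GQ klEngGeo14 (klEngQ9dG klEngGeo14 P R) P R c → ∀ β : ℝ, klBetaMin ≤ β → β ≤ Real.exp (c / U ^ 2) →
        ∀ (L M : ℕ) [NeZero L] [NeZero M], klEngL₄ P R β U ≤ L → klEngM₃ β U L ≤ M →
          ∀ n : ℕ, 1 ≤ n → n ≤ nScales β + 1 → IsKLRegime U c (-(n : ℤ)) →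
            HistP klPredsV17F2 L M klEngGeo14 P (klEngQ9dG klEngGeo14 P R) R β U μ 0 n →
              FrameOK R U (nScales β) μ (klFlowFrameU L M β U μ n) →
                KernelNormsV4 L M P (klEngQ9dG klEngGeo14 P R) β U μ (klFlowFrameU L M β U μ n) n →
                  (∀ j ≤ n, (KernelNormsLevels L M P (klEngQ9dG klEngGeo14 P R) β U μ (klFlowFrameU L M β U μ n) j ∧
                    KernelNormsWt4 L M (klWtBudget P (klEngQ9dG klEngGeo14 P R) U j) β U μ (klFlowFrameU L M β U μ n) j)) →
                    (∀ j ≤ n, LevelsUExportMixedAt L M (klCU2 P R (klEngQ7 P R)) P β U μ j) →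
                      (∀ j ≤ n, IsoTupleLineBAt L M klE5AM klE5cM (klE5dM P R) P β U μ j) →
                        (∀ j ≤ n, PairTransferRelFamilyK5 L M klEngGeoTh P (klCT8 P R (klEngQ7 P R) klEngGeo14 klEngGeoTh) β U μ j) →
      PairLadderStepAtV17F2 L M klEngGeo14 P (klEngQ9dG klEngGeo14 P R) β U μ n := by
  intro P R c hP hR hc hc3 μ hμ U hU hUle β hβ hβc L M _ _ hL hM n hn1 hn hreg hhist hfr hV4 hlev hlevU hiso htr
  obtain ⟨m, hm, hC₀, hsm₀, htower⟩ := hexLadPkg P R c hP hR hc hc3 μ hμ U hU hUle β hβ hβc L M hL hM n hn1 hn hreg hhist hfr hV4 hlev hlevU hiso htr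
  clear hexLadPkg
  have hβL : β ≤ (L : ℝ) := le_of_klEngL₄_le hL
  have hK : FrameOK R U (nScales β) μ (klFlowFrameU L M β U μ (n - 1)) :=
    FrameOK.mono hR.1.2.2 (by omega) (frameOK_klFlowFrameU_self_of_hist hhist hR.1 hμ (n - 1) (by omega))
  have hG : (2 : ℝ) ^ 18 ≤ klEngGeo14.bhi := by rw [klEngGeo14_bhi_eq]; norm_num
  exact pairLadderStepAtV17F2_of_relFamilyK5_klCT8 (G := klEngGeo14) (G' := klEngGeo14) (Gth := klEngGeoTh) (Q := klEngQ9dG klEngGeo14 P R) (Q₀ := klEngQ7 P R)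
    klEngGeoTh_CF_nonneg (zero_le_one.trans hP.1) hn1 hn hm hK hβ hβL hG (htr (n - 1) (by omega)) hC₀ hsm₀ htower

end Lad

end Summit.HubbardSuperconductivity.HubbardSuperconductivity.Theorems.EngineV8

end
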